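import Literature.Probability.RandomPlanarGeometry.SAWCountMonotoneReversal
import HarnessLib

/-!
# Monotonicity `cₙ ≤ cₙ₊₁` (O'Brien 1990): the FRACTIONAL form of the reversal pairing — a weighted
# certificate on the doubly trapped walks suffices

Sequel of `SAWCountMonotoneReversal.lean` (`card_not_doublyTrapped_add_sum_le_count_succ`: the walks outside
`T₂ = doublyTrapped d n` plus any ℕ-valued weight `w` with `w ω' + 2 ≤ extCount ω' n` (or `+ 1` with an open start)
number at most `cₙ₊₁`; `count_le_count_succ_of_doublyTrapped_fibers`: a repair MAP on `T₂` with bounded fibres gives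
`cₙ ≤ cₙ₊₁`).  A map is more than is needed: by the same bookkeeping with RATIONAL weights, it suffices to spread
each doubly trapped walk fractionally over several `n`-step walks, as long as no walk `ω'` receives total mass above
its spare capacity `extCount ω' n - 2` (or `extCount ω' n - 1` when its start is not completely surrounded).  This is
the form in which a certificate for all `n` is expected (lane note `OBRIEN-DESIGN-2.md` §7: with masts of length
`≤ 3` at every extreme visit the measured load/capacity ratio on `ℤ²` stays below `1/4` up to `n = 19`), and it is
the fractional-matching (Hall) formulation of the injection O'Brien constructs.

* `card_not_doublyTrapped_add_sum_le_count_succ_rat` : the weighted pairing lemma with `ℚ`-valued weights;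
* `count_le_count_succ_of_fractional` : **`cₙ ≤ cₙ₊₁` follows from any nonnegative `W : T₂ × 𝒲ₙ → ℚ` with row sums
  `1` on `T₂` and column sums within the spare capacities.**

[cite: MadrasSlade1993, §1.1, §7.1] [cite: BDGS2012, §1.3 (`cₙ ≤ cₙ₊₁`, O'Brien 1990)]
-/

noncomputable section

open Literature.Probability.LatticeModels Literature.Probability.Percolation SimpleGraph
open scoped BigOperators

namespace Literature.Probability.RandomPlanarGeometry.SAW.Zd

variable {d : ℕ}

open Classical in
/-- **Weighted pairing lemma, rational weights.** Let `w ≥ 0` be a `ℚ`-valued weight on `n`-step walks such that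
every walk `ω'` carrying weight has `w ω' + 2 ≤ extCount ω' n`, or `w ω' + 1 ≤ extCount ω' n` together with a start
that is not completely surrounded. Then `#(walks not doubly trapped) + Σ w ≤ cₙ₊₁`. (Same bookkeeping as the
`ℕ`-valued `card_not_doublyTrapped_add_sum_le_count_succ`: the reversal of an end-trapped walk with two free start
sites pays for it, and the hypothesis keeps one further unit free wherever weight sits.) [cite: BDGS2012, §1.3] -/
theorem card_not_doublyTrapped_add_sum_le_count_succ_rat (n : ℕ) (w : (ℕ → Site d) → ℚ)
    (hw0 : ∀ ω', 0 ≤ w ω')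
    (hw : ∀ ω' ∈ saws d n, w ω' = 0 ∨ w ω' + 2 ≤ extCount ω' n ∨
      (w ω' + 1 ≤ extCount ω' n ∧ 1 ≤ extCount (revWalk n ω') n)) :
    ((((saws d n).filter fun ω => ¬ (extCount ω n = 0 ∧ extCount (revWalk n ω) n ≤ 1)).card : ℕ) : ℚ) +
        ∑ ω' ∈ saws d n, w ω' ≤ count d (n + 1) := by
  classical
  set S := saws d n with hS
  set A := S.filter fun ω => 0 < extCount ω n with hA
  set T₁ := S.filter fun ω => extCount ω n = 0 ∧ 2 ≤ extCount (revWalk n ω) n with hT₁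
  set R := T₁.image (revWalk n) with hR
  have hRA : R ⊆ A := by
    intro ω' hω'
    obtain ⟨ω, hω, rfl⟩ := Finset.mem_image.1 hω'
    obtain ⟨hωS, -, h2⟩ := Finset.mem_filter.1 hω
    exact Finset.mem_filter.2 ⟨revWalk_mem_saws hωS, by omega⟩
  have hRcard : R.card = T₁.card :=
    Finset.card_image_of_injOn fun ω₁ h₁ ω₂ h₂ h =>
      revWalk_injOn n (Finset.mem_coe.2 (Finset.mem_filter.1 (Finset.mem_coe.1 h₁)).1)
        (Finset.mem_coe.2 (Finset.mem_filter.1 (Finset.mem_coe.1 h₂)).1) h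
  have hRrev : ∀ ω' ∈ R, extCount (revWalk n ω') n = 0 ∧ 2 ≤ extCount ω' n := by
    intro ω' hω'
    obtain ⟨ω, hω, rfl⟩ := Finset.mem_image.1 hω'
    obtain ⟨hωS, h0, h2⟩ := Finset.mem_filter.1 hω
    rw [revWalk_revWalk hωS]
    exact ⟨h0, h2⟩
  -- weight lives on `A`
  have hwA : ∀ ω' ∈ S, ω' ∉ A → w ω' = 0 := by
    intro ω' hω' hnot
    have h0 : extCount ω' n = 0 := by
      by_contra h
      exact hnot (Finset.mem_filter.2 ⟨hω', Nat.pos_of_ne_zero h⟩)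
    rcases hw ω' hω' with h | h | ⟨h, -⟩
    · exact h
    · have := hw0 ω'; rw [h0] at h; push_cast at h; linarith
    · have := hw0 ω'; rw [h0] at h; push_cast at h; linarith
  -- pointwise on `A`: `1 + [ω' ∈ R] + w ω' ≤ extCount ω' n`
  have hpt : ∀ ω' ∈ A, (1 : ℚ) + (if ω' ∈ R then 1 else 0) + w ω' ≤ (extCount ω' n : ℚ) := by
    intro ω' hω'
    obtain ⟨hω'S, h1⟩ := Finset.mem_filter.1 hω'
    have h1' : (1 : ℚ) ≤ extCount ω' n := by exact_mod_cast h1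
    by_cases hr : ω' ∈ R <;> simp only [hr, if_true, if_false]
    · obtain ⟨hr0, hr2⟩ := hRrev ω' hr
      have hr2' : (2 : ℚ) ≤ extCount ω' n := by exact_mod_cast hr2
      rcases hw ω' hω'S with h | h | ⟨-, h⟩
      · rw [h]; linarith
      · linarith
      · omega
    · rcases hw ω' hω'S with h | h | ⟨h, -⟩
      · rw [h]; linarith
      · linarith
      · linarith
  -- the complement of `T₂` in `S` is `A ∪ T₁` (disjointly)
  have hsplit : (S.filter fun ω => ¬ (extCount ω n = 0 ∧ extCount (revWalk n ω) n ≤ 1)).card =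
      A.card + T₁.card := by
    rw [← Finset.card_union_of_disjoint]
    · congr 1
      ext ω
      simp only [Finset.mem_filter, Finset.mem_union, hA, hT₁, not_and, not_le]
      constructor
      · rintro ⟨hωS, h⟩
        by_cases h0 : extCount ω n = 0
        · exact Or.inr ⟨hωS, h0, h h0⟩
        · exact Or.inl ⟨hωS, Nat.pos_of_ne_zero h0⟩
      · rintro (⟨hωS, h⟩ | ⟨hωS, h0, h2⟩)
        · exact ⟨hωS, fun h0 => absurd h0 (by omega)⟩
        · exact ⟨hωS, fun _ => by omega⟩
    · rw [Finset.disjoint_left]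
      intro ω h₁ h₂
      have := (Finset.mem_filter.1 h₁).2
      have := (Finset.mem_filter.1 h₂).2.1
      omega
  have hwsum : ∑ ω' ∈ S, w ω' = ∑ ω' ∈ A, w ω' :=
    (Finset.sum_subset (Finset.filter_subset _ _) fun ω' hω' hnot => hwA ω' hω' hnot).symm
  have hAR : ((A.card + R.card : ℕ) : ℚ) = ∑ ω' ∈ A, ((1 : ℚ) + (if ω' ∈ R then 1 else 0)) := by
    rw [Finset.sum_add_distrib, Finset.sum_const, nsmul_eq_mul, mul_one, Finset.sum_ite_mem,
      Finset.inter_eq_right.2 hRA, Finset.sum_const, nsmul_eq_mul, mul_one]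
    push_cast; ring
  have hcount : (count d (n + 1) : ℚ) = ∑ ω' ∈ S, (extCount ω' n : ℚ) := by
    rw [count_succ_eq_sum_ext]; push_cast; rfl
  have hAS : ∑ ω' ∈ A, (extCount ω' n : ℚ) ≤ ∑ ω' ∈ S, (extCount ω' n : ℚ) :=
    Finset.sum_le_sum_of_subset_of_nonneg (Finset.filter_subset _ _) fun _ _ _ => by positivity
  calc (((S.filter fun ω => ¬ (extCount ω n = 0 ∧ extCount (revWalk n ω) n ≤ 1)).card : ℕ) : ℚ) +
        (∑ ω' ∈ S, w ω')
      = ((A.card + R.card : ℕ) : ℚ) + (∑ ω' ∈ A, w ω') := by rw [hsplit, hRcard, hwsum]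
    _ = ∑ ω' ∈ A, ((1 : ℚ) + (if ω' ∈ R then 1 else 0) + w ω') := by
        rw [hAR, ← Finset.sum_add_distrib]
    _ ≤ ∑ ω' ∈ A, (extCount ω' n : ℚ) := Finset.sum_le_sum hpt
    _ ≤ ∑ ω' ∈ S, (extCount ω' n : ℚ) := hAS
    _ = count d (n + 1) := hcount.symm

open Classical in
/-- **Reduction of O'Brien's theorem to a FRACTIONAL certificate on the doubly trapped walks.** Suppose every
doubly trapped `n`-step walk `ω` is spread, with nonnegative rational masses `W ω ω'` summing to `1`, over `n`-step
self-avoiding walks `ω'`, and no walk `ω'` receives total mass above `extCount ω' n - 2`, or above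
`extCount ω' n - 1` when its start is not completely surrounded. Then `cₙ ≤ cₙ₊₁`. (The fibre form
`count_le_count_succ_of_doublyTrapped_fibers` is the case of `0/1` masses.) [cite: BDGS2012, §1.3] -/
theorem count_le_count_succ_of_fractional {n : ℕ} (W : (ℕ → Site d) → (ℕ → Site d) → ℚ)
    (hW0 : ∀ ω ω', 0 ≤ W ω ω')
    (hrow : ∀ ω ∈ doublyTrapped d n, ∑ ω' ∈ saws d n, W ω ω' = 1)
    (hcol : ∀ ω' ∈ saws d n,
      (∑ ω ∈ doublyTrapped d n, W ω ω') = 0 ∨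
      (∑ ω ∈ doublyTrapped d n, W ω ω') + 2 ≤ extCount ω' n ∨
      ((∑ ω ∈ doublyTrapped d n, W ω ω') + 1 ≤ extCount ω' n ∧ 1 ≤ extCount (revWalk n ω') n)) :
    count d n ≤ count d (n + 1) := by
  classical
  have h := card_not_doublyTrapped_add_sum_le_count_succ_rat (d := d) n
    (fun ω' => ∑ ω ∈ doublyTrapped d n, W ω ω') (fun ω' => Finset.sum_nonneg fun ω _ => hW0 ω ω') hcol
  have hsum : ∑ ω' ∈ saws d n, ∑ ω ∈ doublyTrapped d n, W ω ω' = ((doublyTrapped d n).card : ℚ) := by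
    rw [Finset.sum_comm, Finset.card_eq_sum_ones, Nat.cast_sum]
    refine Finset.sum_congr rfl fun ω hω => ?_
    rw [hrow ω hω]; push_cast; rfl
  rw [hsum] at h
  have hsplit : count d n =
      ((saws d n).filter fun ω => ¬ (extCount ω n = 0 ∧ extCount (revWalk n ω) n ≤ 1)).card +
        (doublyTrapped d n).card := by
    rw [← card_saws, doublyTrapped, add_comm, Finset.card_filter_add_card_filter_not]
  have : (count d n : ℚ) ≤ count d (n + 1) := by rw [hsplit]; push_cast; exact h
  exact_mod_cast this

end Literature.Probability.RandomPlanarGeometry.SAW.Zd
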